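import Literature.Analysis.Complex.CousinHeftung
import Literature.Analysis.Complex.ProductsNearIdentity
import Literature.Analysis.Complex.LocallyUniformLimitSCV
import Literature.Analysis.Complex.DbarPoincarePolydisc
import Mathlib.Analysis.Calculus.FDeriv.Mul
import Mathlib.Analysis.Normed.Group.FunctionSeries
import HarnessLib

/-!
# Cartan's Heftungslemma for holomorphic invertible matrices (Grauert–Remmert, Kap. III §1.3)

Grauert–Remmert, *Theorie der Steinschen Räume* (1977), Kap. III §1 Nr. 3 ("Lemma von Cartan"),
in the geometry of the Cousin Heftungslemma (`Literature/Analysis/Complex/CousinHeftung.lean`: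
`B' = E' × U`, `B'' = E'' × U`, `D = B' ∩ B''`, bounded holomorphic `q × q` matrices `B(·)`,
`s = q⁻¹ − (2q²)⁻¹`, `K` the Cousin constant):

* **Hilfssatz 3.** For `0 < ε < sK⁻¹`, `t := 9q³K²ε < 1`: every holomorphic `a = e + b ∈ B(D)`
  with `|b|_D ≤ ε` factors over `D` as `a = a' · ã · a''` with `a' = e + b' ∈ B(B')`,
  `a'' = e + b'' ∈ B(B'')`, `ã = e + b̃ ∈ B(D)` and `|b'| ≤ K|b|`, `|b''| ≤ K|b|`, `|b̃| ≤ t|b|`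
  (Cousin: `b = b' + b''`; `a'a'' = a + b'b''`; `ã := a'⁻¹ a a''⁻¹`, `b̃ = −a'⁻¹ b' b'' a''⁻¹`).
* **Satz 4 (Cartansches Heftungslemma).** There is `ε > 0` such that every `a ∈ B(D)` with
  `|a − e|_D ≤ ε` is a product `a = c'|D · c''|D` of invertible `c' ∈ B*(B')`, `c'' ∈ B*(B'')`
  with `|c' − e| ≤ 4K|a − e|`, `|c'' − e| ≤ 4K|a − e|` (iterate Hilfssatz 3: `a_ν = a'_ν a_{ν+1} a''_ν`,
  `|b_ν| ≤ L tᵛ`; the ordered products `uₙ = a'₀⋯a'ₙ`, `vₙ = a''ₙ⋯a''₀` converge by Hilfssatz 2).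

We prove both for functions on `ℂ × P` (`P` a complex normed space, finite-dimensional for
Satz 4) with values in an arbitrary complete normed `ℂ`-algebra `𝔄` with `‖1‖ = 1` (for `q × q`
matrices with a submultiplicative norm this is GR's setting; submultiplicativity turns GR's
constants into `‖a'⁻¹‖ ≤ 2` for `K|b| ≤ ½`, `|b̃| ≤ 4K²|b|²`, `t = 4K²|b|`), on top of the
SHRUNKEN Cousin lemma of the tree (`cousin_heftung`; its constant `K` enters as the hypothesis
`hK`, uniform in `c, d, ε`). Accordingly (`cartan_step`, Hilfssatz 3) `ã`, `b̃` live on the shrunken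
middle box `D₁ = {a' < x < b', c + 2ε < y < d − 2ε} × U₁`, and the iteration
(`cartan_heftung`, Satz 4) runs on the `y`-strips `(cartanLevelLo c ε n, cartanLevelHi d ε n)` shrinking
geometrically to `(c + 2ε, d − 2ε)` (level `n` uses `ε_n = ε/2ⁿ⁺¹`; `K` is uniform because the
heights only decrease) and on a decreasing sequence of parameter opens `U n` with cutoffs `χ n`
(`= 1` on `U (n+1)`) supplied by the caller, the conclusion holding over a terminal open
`U∞ ⊆ ⋂ U n`: `a = c' c''` on `{a' < x < b', c + 2ε < y < d − 2ε} × U∞` with `c'`, `c''`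
holomorphic and invertible on `{a < x < b'} × …`, `{a' < x < b} × …`, `‖c' − 1‖, ‖c'' − 1‖ ≤ 4K‖a − 1‖`
— GR's Satz 4 with `ε_Cartan = (8K²)⁻¹`. The limit functions are holomorphic by Weierstrass'
theorem in several variables (`SCV.differentiableOn_of_tendstoLocallyUniformlyOn`), the ordered
products converge by the estimates of Hilfssatz 2 (`norm_prodOneAdd_sub_one_le`) and the M-test.
Finally `cartan_heftung_polydisc` is the user-facing form for parameters in a polydisc
`D(p₀, r) ⊆ ℂ^ι` (GR's "Quader"): the Cousin constant is taken from `cousin_heftung`, the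
parameter opens are the polydiscs `D(p₀, ρₙ)`, `ρₙ = r∞ + (r − r∞)/2ⁿ`, with product cut-offs
(`exists_polydisc_cutoff_norm_le_one`), and the conclusion holds over `D(p₀, r∞)`, `0 < r∞ < r`:
there are `K ≥ 1`, `β₀ > 0` such that every holomorphic `a` with `‖a − 1‖ ≤ N ≤ β₀` on
`{a' < x < b', c < y < d} × D(p₀, r)` is a product `c' c''` of holomorphic invertible functions on
the shrunken boxes with `‖c' − 1‖, ‖c'' − 1‖ ≤ 4KN` (GR: `|c' − e| ≤ 4K|a − e|_D`).

## References

* H. Grauert, R. Remmert, *Theorie der Steinschen Räume*, Grundlehren 227 (1977), Kap. III §1.3,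
  Hilfssatz 3 and Satz 4 (Cartansches Heftungslemma) [GrauertRemmert1977].
* H. Cartan, *Sur les matrices holomorphes de `n` variables complexes*, J. Math. Pures Appl. 19
  (1940) 1–26 (the original).
-/

noncomputable section

open Complex Metric Set Filter
open scoped Topology

namespace Literature.Analysis.Complex

section CartanStep

variable {P : Type*} [NormedAddCommGroup P] [NormedSpace ℂ P]
  {𝔄 : Type*} [NormedRing 𝔄] [NormedAlgebra ℂ 𝔄] [CompleteSpace 𝔄] [NormOneClass 𝔄]

omit [NormedAlgebra ℂ 𝔄] in
/-- In a complete normed ring, `1 + x` with `‖x‖ ≤ ½` is a unit with `‖(1 + x)⁻¹‖ ≤ 2` (Neumann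
series; GR Kap. III §1.2: `|a⁻¹| ≤ 3` for `|a − e| ≤ s`). [cite: GrauertRemmert1977, Kap. III §1.2] -/
theorem isUnit_one_add_and_norm_inverse_le_two {x : 𝔄} (hx : ‖x‖ ≤ 1 / 2) :
    IsUnit (1 + x) ∧ ‖Ring.inverse (1 + x)‖ ≤ 2 := by
  have h1 : ‖(1 : 𝔄) - (1 + x)‖ ≤ 1 / 2 := by
    rw [sub_add_cancel_left, norm_neg]; exact hx
  have h1' : ‖(1 : 𝔄) - (1 + x)‖ < 1 := h1.trans_lt (by norm_num)
  refine ⟨isUnit_of_norm_sub_one_lt (by rwa [norm_sub_rev]), ?_⟩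
  refine (norm_inverse_le_of_norm_one_sub_lt h1').trans ?_
  rw [show (2 : ℝ) = (1 - 1 / 2)⁻¹ by norm_num]
  exact inv_anti₀ (by norm_num) (by linarith)

/-- **Grauert–Remmert, Kap. III §1.3, Hilfssatz 3 (one step of Cartan's iteration), shrunken
form.** Let `K ≥ 1` be a Cousin constant for the `x`-geometry `a ≤ a' < a' + δ < b' − δ < b' ≤ b`
and heights `≤ Δ` (hypothesis `hK` = the conclusion of `cousin_heftung`). Let `b` be holomorphic
on `D = {a' < x < b', c < y < d} × U` with `‖b‖ ≤ β` there, `Kβ ≤ ½`, and let `χ₃` be a parameter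
cutoff (`C¹`, compact support in `U`, `= 1` on the open `U₁`, `|χ₃| ≤ 1`). Then with the Cousin
splitting `b = b' + b''` (`‖b'‖, ‖b''‖ ≤ Kβ`, so `a' = 1 + b'`, `a'' = 1 + b''` are invertible with
inverses of norm `≤ 2`) and `b̃ := a'⁻¹ (1 + b) a''⁻¹ − 1 = −a'⁻¹ b' b'' a''⁻¹` we have, on the
shrunken middle box `D₁ = {a' < x < b', c + 2ε < y < d − 2ε} × U₁`:
`1 + b = (1 + b')(1 + b̃)(1 + b'')`, `b̃` holomorphic and `‖b̃‖ ≤ 4K²β²`.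
[cite: GrauertRemmert1977, Kap. III §1.3 Hilfssatz 3] -/
theorem cartan_step {a a' b' b Δ K : ℝ} (haa' : a ≤ a') (hb'b : b' ≤ b)
    (hK : ∀ (c d ε : ℝ) (f : ℂ × P → 𝔄) (U U₁ : Set P) (χ₃ : P → ℂ) (N : ℝ),
      |d - c| ≤ Δ → 0 < ε →
      IsOpen U → IsOpen U₁ → ContDiff ℝ 1 χ₃ → HasCompactSupport χ₃ → tsupport χ₃ ⊆ U →
      (∀ p ∈ U₁, χ₃ p = 1) → (∀ p, ‖χ₃ p‖ ≤ 1) → 0 ≤ N →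
      DifferentiableOn ℂ f
        {z : ℂ × P | a' < z.1.re ∧ z.1.re < b' ∧ c < z.1.im ∧ z.1.im < d ∧ z.2 ∈ U} →
      (∀ z : ℂ × P, a' < z.1.re → z.1.re < b' → c < z.1.im → z.1.im < d → z.2 ∈ U →
        ‖f z‖ ≤ N) →
      ∃ f' f'' : ℂ × P → 𝔄,
        DifferentiableOn ℂ f'
          {z : ℂ × P | z.1.re < b' ∧ c + 2 * ε < z.1.im ∧ z.1.im < d - 2 * ε ∧ z.2 ∈ U₁} ∧
        DifferentiableOn ℂ f''
          {z : ℂ × P | a' < z.1.re ∧ c + 2 * ε < z.1.im ∧ z.1.im < d - 2 * ε ∧ z.2 ∈ U₁} ∧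
        (∀ z : ℂ × P, a' < z.1.re → z.1.re < b' → c + 2 * ε < z.1.im → z.1.im < d - 2 * ε →
          z.2 ∈ U₁ → f z = f' z + f'' z) ∧
        (∀ z : ℂ × P, a < z.1.re → z.1.re < b' → c < z.1.im → z.1.im < d → ‖f' z‖ ≤ K * N) ∧
        (∀ z : ℂ × P, a' < z.1.re → z.1.re < b → c < z.1.im → z.1.im < d → ‖f'' z‖ ≤ K * N))
    {c d ε β : ℝ} {U U₁ : Set P} {χ₃ : P → ℂ} {bf : ℂ × P → 𝔄}
    (hΔ : |d - c| ≤ Δ) (hε : 0 < ε) (hU : IsOpen U) (hU₁ : IsOpen U₁) (hχd : ContDiff ℝ 1 χ₃)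
    (hχc : HasCompactSupport χ₃) (hχU : tsupport χ₃ ⊆ U) (hχ1 : ∀ p ∈ U₁, χ₃ p = 1)
    (hχle : ∀ p, ‖χ₃ p‖ ≤ 1) (hβ : 0 ≤ β) (hKβ : K * β ≤ 1 / 2)
    (hb : DifferentiableOn ℂ bf
      {z : ℂ × P | a' < z.1.re ∧ z.1.re < b' ∧ c < z.1.im ∧ z.1.im < d ∧ z.2 ∈ U})
    (hbβ : ∀ z : ℂ × P, a' < z.1.re → z.1.re < b' → c < z.1.im → z.1.im < d → z.2 ∈ U →
      ‖bf z‖ ≤ β) :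
    ∃ b₁ b₂ bt : ℂ × P → 𝔄,
      DifferentiableOn ℂ b₁
        {z : ℂ × P | z.1.re < b' ∧ c + 2 * ε < z.1.im ∧ z.1.im < d - 2 * ε ∧ z.2 ∈ U₁} ∧
      DifferentiableOn ℂ b₂
        {z : ℂ × P | a' < z.1.re ∧ c + 2 * ε < z.1.im ∧ z.1.im < d - 2 * ε ∧ z.2 ∈ U₁} ∧
      (∀ z : ℂ × P, a < z.1.re → z.1.re < b' → c < z.1.im → z.1.im < d → ‖b₁ z‖ ≤ K * β) ∧
      (∀ z : ℂ × P, a' < z.1.re → z.1.re < b → c < z.1.im → z.1.im < d → ‖b₂ z‖ ≤ K * β) ∧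
      (∀ z : ℂ × P, a < z.1.re → z.1.re < b' → c < z.1.im → z.1.im < d →
        IsUnit (1 + b₁ z) ∧ ‖Ring.inverse (1 + b₁ z)‖ ≤ 2) ∧
      (∀ z : ℂ × P, a' < z.1.re → z.1.re < b → c < z.1.im → z.1.im < d →
        IsUnit (1 + b₂ z) ∧ ‖Ring.inverse (1 + b₂ z)‖ ≤ 2) ∧
      DifferentiableOn ℂ bt
        {z : ℂ × P | a' < z.1.re ∧ z.1.re < b' ∧ c + 2 * ε < z.1.im ∧ z.1.im < d - 2 * ε ∧
          z.2 ∈ U₁} ∧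
      (∀ z : ℂ × P, a' < z.1.re → z.1.re < b' → c + 2 * ε < z.1.im → z.1.im < d - 2 * ε →
        z.2 ∈ U₁ → ‖bt z‖ ≤ 4 * K ^ 2 * β ^ 2) ∧
      (∀ z : ℂ × P, a' < z.1.re → z.1.re < b' → c + 2 * ε < z.1.im → z.1.im < d - 2 * ε →
        z.2 ∈ U₁ → 1 + bf z = (1 + b₁ z) * (1 + bt z) * (1 + b₂ z)) := by
  obtain ⟨b₁, b₂, hol₁, hol₂, hsplit, hbd₁, hbd₂⟩ :=
    hK c d ε bf U U₁ χ₃ β hΔ hε hU hU₁ hχd hχc hχU hχ1 hχle hβ hb hbβ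
  have hU₁U : U₁ ⊆ U := fun p hp ↦
    hχU (subset_tsupport _ (by simp [Function.mem_support, hχ1 p hp]))
  -- the units `a' = 1 + b₁`, `a'' = 1 + b₂`
  have hKβ' : K * β ≤ 1 / 2 := hKβ
  have hu₁ : ∀ z : ℂ × P, a < z.1.re → z.1.re < b' → c < z.1.im → z.1.im < d →
      IsUnit (1 + b₁ z) ∧ ‖Ring.inverse (1 + b₁ z)‖ ≤ 2 := fun z h1 h2 h3 h4 ↦
    isUnit_one_add_and_norm_inverse_le_two ((hbd₁ z h1 h2 h3 h4).trans hKβ')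
  have hu₂ : ∀ z : ℂ × P, a' < z.1.re → z.1.re < b → c < z.1.im → z.1.im < d →
      IsUnit (1 + b₂ z) ∧ ‖Ring.inverse (1 + b₂ z)‖ ≤ 2 := fun z h1 h2 h3 h4 ↦
    isUnit_one_add_and_norm_inverse_le_two ((hbd₂ z h1 h2 h3 h4).trans hKβ')
  set bt : ℂ × P → 𝔄 := fun z ↦
    Ring.inverse (1 + b₁ z) * (1 + bf z) * Ring.inverse (1 + b₂ z) - 1 with hbt
  refine ⟨b₁, b₂, bt, hol₁, hol₂, hbd₁, hbd₂, hu₁, hu₂, ?_, ?_, ?_⟩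
  · -- holomorphy of `b̃` on `D₁`
    have hD₁D : {z : ℂ × P | a' < z.1.re ∧ z.1.re < b' ∧ c + 2 * ε < z.1.im ∧
        z.1.im < d - 2 * ε ∧ z.2 ∈ U₁} ⊆
        {z : ℂ × P | a' < z.1.re ∧ z.1.re < b' ∧ c < z.1.im ∧ z.1.im < d ∧ z.2 ∈ U} :=
      fun z ⟨h1, h2, h3, h4, h5⟩ ↦ ⟨h1, h2, by linarith, by linarith, hU₁U h5⟩
    have hbf : DifferentiableOn ℂ (fun z ↦ 1 + bf z) _ := (hb.mono hD₁D).const_add 1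
    have hsub₁ : {z : ℂ × P | a' < z.1.re ∧ z.1.re < b' ∧ c + 2 * ε < z.1.im ∧
        z.1.im < d - 2 * ε ∧ z.2 ∈ U₁} ⊆
        {z : ℂ × P | z.1.re < b' ∧ c + 2 * ε < z.1.im ∧ z.1.im < d - 2 * ε ∧ z.2 ∈ U₁} :=
      fun z ⟨_, h2, h3, h4, h5⟩ ↦ ⟨h2, h3, h4, h5⟩
    have hsub₂ : {z : ℂ × P | a' < z.1.re ∧ z.1.re < b' ∧ c + 2 * ε < z.1.im ∧
        z.1.im < d - 2 * ε ∧ z.2 ∈ U₁} ⊆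
        {z : ℂ × P | a' < z.1.re ∧ c + 2 * ε < z.1.im ∧ z.1.im < d - 2 * ε ∧ z.2 ∈ U₁} :=
      fun z ⟨h1, _, h3, h4, h5⟩ ↦ ⟨h1, h3, h4, h5⟩
    have hunit₁ : ∀ z ∈ {z : ℂ × P | a' < z.1.re ∧ z.1.re < b' ∧ c + 2 * ε < z.1.im ∧
        z.1.im < d - 2 * ε ∧ z.2 ∈ U₁}, IsUnit (1 + b₁ z) :=
      fun z ⟨h1, h2, h3, h4, _⟩ ↦ (hu₁ z (by linarith) h2 (by linarith) (by linarith)).1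
    have hunit₂ : ∀ z ∈ {z : ℂ × P | a' < z.1.re ∧ z.1.re < b' ∧ c + 2 * ε < z.1.im ∧
        z.1.im < d - 2 * ε ∧ z.2 ∈ U₁}, IsUnit (1 + b₂ z) :=
      fun z ⟨h1, h2, h3, h4, _⟩ ↦ (hu₂ z h1 (by linarith) (by linarith) (by linarith)).1
    have hb₁' : DifferentiableOn ℂ (fun z ↦ Ring.inverse (1 + b₁ z))
        {z : ℂ × P | a' < z.1.re ∧ z.1.re < b' ∧ c + 2 * ε < z.1.im ∧
          z.1.im < d - 2 * ε ∧ z.2 ∈ U₁} :=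
      ((hol₁.mono hsub₁).const_add 1).inverse hunit₁
    have hb₂' : DifferentiableOn ℂ (fun z ↦ Ring.inverse (1 + b₂ z))
        {z : ℂ × P | a' < z.1.re ∧ z.1.re < b' ∧ c + 2 * ε < z.1.im ∧
          z.1.im < d - 2 * ε ∧ z.2 ∈ U₁} :=
      ((hol₂.mono hsub₂).const_add 1).inverse hunit₂
    exact ((hb₁'.mul hbf).mul hb₂').sub_const 1
  · -- the bound `‖b̃‖ ≤ 4K²β²`
    intro z h1 h2 h3 h4 h5
    obtain ⟨hu1, hn1⟩ := hu₁ z (by linarith) h2 (by linarith) (by linarith)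
    obtain ⟨hu2, hn2⟩ := hu₂ z h1 (by linarith) (by linarith) (by linarith)
    have hs : bf z = b₁ z + b₂ z := hsplit z h1 h2 h3 h4 h5
    have key : bt z = -(Ring.inverse (1 + b₁ z) * b₁ z * b₂ z * Ring.inverse (1 + b₂ z)) := by
      have e1 : (1 : 𝔄) + bf z = (1 + b₁ z) * (1 + b₂ z) - b₁ z * b₂ z := by
        rw [hs]; noncomm_ring
      simp only [hbt, e1, mul_sub, sub_mul, ← mul_assoc, Ring.inverse_mul_cancel _ hu1, one_mul]
      rw [Ring.mul_inverse_cancel _ hu2]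
      noncomm_ring
    rw [key, norm_neg]
    have hb1 := hbd₁ z (by linarith) h2 (by linarith) (by linarith)
    have hb2 := hbd₂ z h1 (by linarith) (by linarith) (by linarith)
    have hKβ0 : 0 ≤ K * β := (norm_nonneg _).trans hb1
    calc ‖Ring.inverse (1 + b₁ z) * b₁ z * b₂ z * Ring.inverse (1 + b₂ z)‖
        ≤ ‖Ring.inverse (1 + b₁ z)‖ * ‖b₁ z‖ * ‖b₂ z‖ * ‖Ring.inverse (1 + b₂ z)‖ :=
          (norm_mul_le _ _).trans (mul_le_mul_of_nonneg_right ((norm_mul_le _ _).trans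
            (mul_le_mul_of_nonneg_right (norm_mul_le _ _) (norm_nonneg _))) (norm_nonneg _))
      _ ≤ 2 * (K * β) * (K * β) * 2 := by gcongr
      _ = 4 * K ^ 2 * β ^ 2 := by ring
  · -- the factorisation `1 + b = (1 + b₁)(1 + b̃)(1 + b₂)`
    intro z h1 h2 h3 h4 h5
    obtain ⟨hu1, -⟩ := hu₁ z (by linarith) h2 (by linarith) (by linarith)
    obtain ⟨hu2, -⟩ := hu₂ z h1 (by linarith) (by linarith) (by linarith)
    simp only [hbt, add_sub_cancel]
    rw [← mul_assoc, ← mul_assoc, Ring.mul_inverse_cancel _ hu1, one_mul, mul_assoc,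
      Ring.inverse_mul_cancel _ hu2, mul_one]

end CartanStep

section CartanIteration

variable {P : Type*} [NormedAddCommGroup P] [NormedSpace ℂ P] [FiniteDimensional ℂ P]
  {𝔄 : Type*} [NormedRing 𝔄] [NormedAlgebra ℂ 𝔄] [CompleteSpace 𝔄] [NormOneClass 𝔄]

/-! ### The shrinking `y`-strips of the iteration -/

/-- Lower ends of the `y`-strips of Cartan's iteration: `c_n = c + 2ε − 2ε/2ⁿ` (`c₀ = c`,
`c_{n+1} = c_n + 2ε_n` with `ε_n = ε/2ⁿ⁺¹`, `c_n ↑ c + 2ε`). [folklore] -/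
def cartanLevelLo (c ε : ℝ) (n : ℕ) : ℝ := c + 2 * ε - 2 * ε / 2 ^ n

/-- Upper ends of the `y`-strips: `d_n = d − 2ε + 2ε/2ⁿ` (`d₀ = d`, `d_n ↓ d − 2ε`). [folklore] -/
def cartanLevelHi (d ε : ℝ) (n : ℕ) : ℝ := d - 2 * ε + 2 * ε / 2 ^ n

/-- `c₀ = c`. [folklore] -/
theorem cartanLevelLo_zero (c ε : ℝ) : cartanLevelLo c ε 0 = c := by simp [cartanLevelLo]

/-- `d₀ = d`. [folklore] -/
theorem cartanLevelHi_zero (d ε : ℝ) : cartanLevelHi d ε 0 = d := by simp [cartanLevelHi]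

/-- `c_{n+1} = c_n + 2 ε_n`, `ε_n = ε / 2ⁿ⁺¹`. [folklore] -/
theorem cartanLevelLo_succ (c ε : ℝ) (n : ℕ) :
    cartanLevelLo c ε (n + 1) = cartanLevelLo c ε n + 2 * (ε / 2 ^ (n + 1)) := by
  simp only [cartanLevelLo, pow_succ]
  field_simp
  ring

/-- `d_{n+1} = d_n − 2 ε_n`. [folklore] -/
theorem cartanLevelHi_succ (d ε : ℝ) (n : ℕ) :
    cartanLevelHi d ε (n + 1) = cartanLevelHi d ε n - 2 * (ε / 2 ^ (n + 1)) := by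
  simp only [cartanLevelHi, pow_succ]
  field_simp
  ring

/-- `c_n < c + 2ε`. [folklore] -/
theorem cartanLevelLo_lt {c ε : ℝ} (hε : 0 < ε) (n : ℕ) :
    cartanLevelLo c ε n < c + 2 * ε := by
  simp only [cartanLevelLo]
  have : 0 < 2 * ε / 2 ^ n := by positivity
  linarith

/-- `d − 2ε < d_n`. [folklore] -/
theorem lt_cartanLevelHi {d ε : ℝ} (hε : 0 < ε) (n : ℕ) :
    d - 2 * ε < cartanLevelHi d ε n := by
  simp only [cartanLevelHi]
  have : 0 < 2 * ε / 2 ^ n := by positivity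
  linarith

/-- `c ≤ c_n`. [folklore] -/
theorem le_cartanLevelLo {c ε : ℝ} (hε : 0 ≤ ε) (n : ℕ) : c ≤ cartanLevelLo c ε n := by
  simp only [cartanLevelLo]
  have h1 : (1 : ℝ) ≤ 2 ^ n := one_le_pow₀ (by norm_num)
  have : 2 * ε / 2 ^ n ≤ 2 * ε := div_le_self (by positivity) h1
  linarith

/-- `d_n ≤ d`. [folklore] -/
theorem cartanLevelHi_le {d ε : ℝ} (hε : 0 ≤ ε) (n : ℕ) : cartanLevelHi d ε n ≤ d := by
  simp only [cartanLevelHi]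
  have h1 : (1 : ℝ) ≤ 2 ^ n := one_le_pow₀ (by norm_num)
  have : 2 * ε / 2 ^ n ≤ 2 * ε := div_le_self (by positivity) h1
  linarith

/-- The lower ends increase. [folklore] -/
theorem cartanLevelLo_le_succ {c ε : ℝ} (hε : 0 ≤ ε) (n : ℕ) :
    cartanLevelLo c ε n ≤ cartanLevelLo c ε (n + 1) := by
  rw [cartanLevelLo_succ]
  have : 0 ≤ 2 * (ε / 2 ^ (n + 1)) := by positivity
  linarith

/-- The upper ends decrease. [folklore] -/
theorem cartanLevelHi_succ_le {d ε : ℝ} (hε : 0 ≤ ε) (n : ℕ) :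
    cartanLevelHi d ε (n + 1) ≤ cartanLevelHi d ε n := by
  rw [cartanLevelHi_succ]
  have : 0 ≤ 2 * (ε / 2 ^ (n + 1)) := by positivity
  linarith

omit [NormedSpace ℂ P] [FiniteDimensional ℂ P] in
/-- The terminal boxes `{α < x < β, γ < y < η} × V` are open. [folklore] -/
private theorem isOpen_box' (α β γ η : ℝ) {V : Set P} (hV : IsOpen V) :
    IsOpen {z : ℂ × P | α < z.1.re ∧ z.1.re < β ∧ γ < z.1.im ∧ z.1.im < η ∧ z.2 ∈ V} := by
  have hre : Continuous fun z : ℂ × P ↦ z.1.re := continuous_re.comp continuous_fst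
  have him : Continuous fun z : ℂ × P ↦ z.1.im := continuous_im.comp continuous_fst
  simp only [setOf_and]
  exact (isOpen_lt continuous_const hre).inter ((isOpen_lt hre continuous_const).inter
    ((isOpen_lt continuous_const him).inter ((isOpen_lt him continuous_const).inter
    (hV.preimage continuous_snd))))

omit [NormedAlgebra ℂ 𝔄] [CompleteSpace 𝔄] [NormOneClass 𝔄] [NormedSpace ℂ P]
  [FiniteDimensional ℂ P] in
/-- A sequence of functions which does not depend on the index converges uniformly. [folklore] -/
private theorem tendstoUniformlyOn_of_forall_eq {X : Type*} {Fs : ℕ → X → 𝔄} {f : X → 𝔄}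
    {s : Set X} (h : ∀ n x, Fs n x = f x) : TendstoUniformlyOn Fs f atTop s :=
  Metric.tendstoUniformlyOn_iff.2 fun ε hε ↦ Eventually.of_forall fun n x _ ↦ by
    rw [h n x, dist_self]; exact hε

/-- **Cartan's Heftungslemma (Grauert–Remmert, Kap. III §1.3, Satz 4), shrunken form.**
Let `K ≥ 1` be a Cousin constant for the `x`-geometry `a ≤ a' < b' ≤ b` and heights `≤ Δ`
(`hK` = the conclusion of `cousin_heftung`), `ε > 0`, `c + 2ε ≤ d − 2ε`, `|d − c| ≤ Δ`, and let
`U n` be opens of `P` with parameter cutoffs `χ n` (`C¹`, compact support in `U n`, `= 1` on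
`U (n+1)`, `|χ n| ≤ 1`) and `U∞` an open set contained in every `U n`. If `a` is holomorphic on
`D = {a' < x < b', c < y < d} × U 0` with `‖a − 1‖ ≤ β₀` there and `8K²β₀ ≤ 1`, then there are
`c'`, `c''`, holomorphic on `B'∞ = {a < x < b', c + 2ε < y < d − 2ε} × U∞`, resp.
`B''∞ = {a' < x < b, c + 2ε < y < d − 2ε} × U∞`, with invertible values and
`‖c' − 1‖, ‖c'' − 1‖ ≤ 4Kβ₀` there, such that `a = c' · c''` on
`D∞ = {a' < x < b', c + 2ε < y < d − 2ε} × U∞`. (GR: `ε_Cartan = (8K²)⁻¹`; `a_ν = a'_ν a_{ν+1} a''_ν`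
by Hilfssatz 3 with `|b_ν| ≤ β₀ tᵛ`, `t = 4K²β₀ ≤ ½`; `c' = lim a'₀⋯a'ₙ`, `c'' = lim a''ₙ⋯a''₀`.)
[cite: GrauertRemmert1977, Kap. III §1.3 Satz 4] -/
theorem cartan_heftung {a a' b' b Δ K : ℝ} (haa' : a ≤ a') (hb'b : b' ≤ b) (hK1 : 1 ≤ K)
    (hK : ∀ (c d ε : ℝ) (f : ℂ × P → 𝔄) (U U₁ : Set P) (χ₃ : P → ℂ) (N : ℝ),
      |d - c| ≤ Δ → 0 < ε →
      IsOpen U → IsOpen U₁ → ContDiff ℝ 1 χ₃ → HasCompactSupport χ₃ → tsupport χ₃ ⊆ U →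
      (∀ p ∈ U₁, χ₃ p = 1) → (∀ p, ‖χ₃ p‖ ≤ 1) → 0 ≤ N →
      DifferentiableOn ℂ f
        {z : ℂ × P | a' < z.1.re ∧ z.1.re < b' ∧ c < z.1.im ∧ z.1.im < d ∧ z.2 ∈ U} →
      (∀ z : ℂ × P, a' < z.1.re → z.1.re < b' → c < z.1.im → z.1.im < d → z.2 ∈ U →
        ‖f z‖ ≤ N) →
      ∃ f' f'' : ℂ × P → 𝔄,
        DifferentiableOn ℂ f'
          {z : ℂ × P | z.1.re < b' ∧ c + 2 * ε < z.1.im ∧ z.1.im < d - 2 * ε ∧ z.2 ∈ U₁} ∧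
        DifferentiableOn ℂ f''
          {z : ℂ × P | a' < z.1.re ∧ c + 2 * ε < z.1.im ∧ z.1.im < d - 2 * ε ∧ z.2 ∈ U₁} ∧
        (∀ z : ℂ × P, a' < z.1.re → z.1.re < b' → c + 2 * ε < z.1.im → z.1.im < d - 2 * ε →
          z.2 ∈ U₁ → f z = f' z + f'' z) ∧
        (∀ z : ℂ × P, a < z.1.re → z.1.re < b' → c < z.1.im → z.1.im < d → ‖f' z‖ ≤ K * N) ∧
        (∀ z : ℂ × P, a' < z.1.re → z.1.re < b → c < z.1.im → z.1.im < d → ‖f'' z‖ ≤ K * N))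
    {c d ε β₀ : ℝ} (hε : 0 < ε) (hcd : c + 2 * ε ≤ d - 2 * ε) (hΔ : |d - c| ≤ Δ)
    (hβ₀ : 0 ≤ β₀) (hsmall : 8 * K ^ 2 * β₀ ≤ 1)
    {U : ℕ → Set P} {χ : ℕ → P → ℂ} {Uinf : Set P} (hUo : ∀ n, IsOpen (U n))
    (hχd : ∀ n, ContDiff ℝ 1 (χ n)) (hχc : ∀ n, HasCompactSupport (χ n))
    (hχU : ∀ n, tsupport (χ n) ⊆ U n) (hχ1 : ∀ n, ∀ p ∈ U (n + 1), χ n p = 1)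
    (hχle : ∀ n p, ‖χ n p‖ ≤ 1) (hUinfo : IsOpen Uinf) (hUinf : ∀ n, Uinf ⊆ U n)
    {af : ℂ × P → 𝔄}
    (haf : DifferentiableOn ℂ af
      {z : ℂ × P | a' < z.1.re ∧ z.1.re < b' ∧ c < z.1.im ∧ z.1.im < d ∧ z.2 ∈ U 0})
    (hafβ : ∀ z : ℂ × P, a' < z.1.re → z.1.re < b' → c < z.1.im → z.1.im < d → z.2 ∈ U 0 →
      ‖af z - 1‖ ≤ β₀) :
    ∃ c₁ c₂ : ℂ × P → 𝔄,
      DifferentiableOn ℂ c₁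
        {z : ℂ × P | a < z.1.re ∧ z.1.re < b' ∧ c + 2 * ε < z.1.im ∧ z.1.im < d - 2 * ε ∧
          z.2 ∈ Uinf} ∧
      DifferentiableOn ℂ c₂
        {z : ℂ × P | a' < z.1.re ∧ z.1.re < b ∧ c + 2 * ε < z.1.im ∧ z.1.im < d - 2 * ε ∧
          z.2 ∈ Uinf} ∧
      (∀ z : ℂ × P, a < z.1.re → z.1.re < b' → c + 2 * ε < z.1.im → z.1.im < d - 2 * ε →
        z.2 ∈ Uinf → IsUnit (c₁ z) ∧ ‖c₁ z - 1‖ ≤ 4 * K * β₀) ∧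
      (∀ z : ℂ × P, a' < z.1.re → z.1.re < b → c + 2 * ε < z.1.im → z.1.im < d - 2 * ε →
        z.2 ∈ Uinf → IsUnit (c₂ z) ∧ ‖c₂ z - 1‖ ≤ 4 * K * β₀) ∧
      (∀ z : ℂ × P, a' < z.1.re → z.1.re < b' → c + 2 * ε < z.1.im → z.1.im < d - 2 * ε →
        z.2 ∈ Uinf → af z = c₁ z * c₂ z) := by
  /- constants -/
  have hK0 : 0 < K := by linarith
  set t : ℝ := 4 * K ^ 2 * β₀ with ht
  have ht0 : 0 ≤ t := by positivity
  have ht1 : t ≤ 1 / 2 := by rw [ht]; linarith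
  have ht1' : t < 1 := by linarith
  have htle1 : t ≤ 1 := by linarith
  have hKβ : K * β₀ ≤ 1 / 8 := by
    have : K * β₀ ≤ K ^ 2 * β₀ := by
      rw [sq]; exact mul_le_mul_of_nonneg_right (le_mul_of_one_le_left hK0.le hK1) hβ₀
    linarith
  set βs : ℕ → ℝ := fun n ↦ β₀ * t ^ n with hβs
  have hβs0 : ∀ n, 0 ≤ βs n := fun n ↦ by positivity
  have hβsle : ∀ n, βs n ≤ β₀ := fun n ↦ by
    simpa [hβs] using mul_le_mul_of_nonneg_left (pow_le_one₀ ht0 htle1) hβ₀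
  have hKβs : ∀ n, K * βs n ≤ 1 / 2 := fun n ↦
    (mul_le_mul_of_nonneg_left (hβsle n) hK0.le).trans (by linarith)
  have hβs_step : ∀ n, 4 * K ^ 2 * βs n ^ 2 ≤ βs (n + 1) := fun n ↦ by
    have e : 4 * K ^ 2 * βs n ^ 2 = β₀ * t ^ (2 * n + 1) := by
      simp only [hβs, ht]; ring
    rw [e]
    exact mul_le_mul_of_nonneg_left (pow_le_pow_of_le_one ht0 htle1 (by omega)) hβ₀
  /- levels -/
  set lo : ℕ → ℝ := cartanLevelLo c ε with hlo
  set hi : ℕ → ℝ := cartanLevelHi d ε with hhi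
  set es : ℕ → ℝ := fun n ↦ ε / 2 ^ (n + 1) with hes
  have hes0 : ∀ n, 0 < es n := fun n ↦ by positivity
  have hlo_succ : ∀ n, lo (n + 1) = lo n + 2 * es n := fun n ↦ cartanLevelLo_succ c ε n
  have hhi_succ : ∀ n, hi (n + 1) = hi n - 2 * es n := fun n ↦ cartanLevelHi_succ d ε n
  have hlo_lt : ∀ n, lo n < c + 2 * ε := fun n ↦ cartanLevelLo_lt hε n
  have hhi_gt : ∀ n, d - 2 * ε < hi n := fun n ↦ lt_cartanLevelHi hε n
  have hc_lo : ∀ n, c ≤ lo n := fun n ↦ le_cartanLevelLo hε.le n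
  have hhi_d : ∀ n, hi n ≤ d := fun n ↦ cartanLevelHi_le hε.le n
  have hlo_mono : ∀ n, lo n ≤ lo (n + 1) := fun n ↦ cartanLevelLo_le_succ hε.le n
  have hhi_anti : ∀ n, hi (n + 1) ≤ hi n := fun n ↦ cartanLevelHi_succ_le hε.le n
  have hΔn : ∀ n, |hi n - lo n| ≤ Δ := fun n ↦ by
    have h1 : lo n < hi n := by linarith [hlo_lt n, hhi_gt n]
    rw [abs_of_pos (sub_pos.2 h1)]
    have : hi n - lo n ≤ d - c := by linarith [hc_lo n, hhi_d n]
    exact this.trans ((le_abs_self _).trans hΔ)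
  have hUanti : ∀ n, U (n + 1) ⊆ U n := fun n p hp ↦
    hχU n (subset_tsupport _ (by simp [Function.mem_support, hχ1 n p hp]))
  have hUinf' : ∀ n, Uinf ⊆ U (n + 1) := fun n ↦ hUinf (n + 1)
  /- the induction hypothesis and the step -/
  let Hyp : ℕ → (ℂ × P → 𝔄) → Prop := fun n g ↦
    DifferentiableOn ℂ g
      {z : ℂ × P | a' < z.1.re ∧ z.1.re < b' ∧ lo n < z.1.im ∧ z.1.im < hi n ∧ z.2 ∈ U n} ∧
    ∀ z : ℂ × P, a' < z.1.re → z.1.re < b' → lo n < z.1.im → z.1.im < hi n → z.2 ∈ U n →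
      ‖g z‖ ≤ βs n
  let Q : ℕ → (ℂ × P → 𝔄) → (ℂ × P → 𝔄) → (ℂ × P → 𝔄) → (ℂ × P → 𝔄) → Prop :=
    fun n g b₁ b₂ g' ↦
    DifferentiableOn ℂ b₁
      {z : ℂ × P | z.1.re < b' ∧ lo (n + 1) < z.1.im ∧ z.1.im < hi (n + 1) ∧ z.2 ∈ U (n + 1)} ∧
    DifferentiableOn ℂ b₂
      {z : ℂ × P | a' < z.1.re ∧ lo (n + 1) < z.1.im ∧ z.1.im < hi (n + 1) ∧ z.2 ∈ U (n + 1)} ∧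
    (∀ z : ℂ × P, a < z.1.re → z.1.re < b' → lo n < z.1.im → z.1.im < hi n → ‖b₁ z‖ ≤ K * βs n) ∧
    (∀ z : ℂ × P, a' < z.1.re → z.1.re < b → lo n < z.1.im → z.1.im < hi n → ‖b₂ z‖ ≤ K * βs n) ∧
    (∀ z : ℂ × P, a' < z.1.re → z.1.re < b' → lo (n + 1) < z.1.im → z.1.im < hi (n + 1) →
      z.2 ∈ U (n + 1) → 1 + g z = (1 + b₁ z) * (1 + g' z) * (1 + b₂ z))
  have hstep : ∀ n g, Hyp n g → ∃ b₁ b₂ g', Hyp (n + 1) g' ∧ Q n g b₁ b₂ g' := by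
    rintro n g ⟨hg, hgb⟩
    obtain ⟨b₁, b₂, bt, hol₁, hol₂, hbd₁, hbd₂, -, -, holt, hbt, hfac⟩ :=
      cartan_step (𝔄 := 𝔄) haa' hb'b hK (c := lo n) (d := hi n) (ε := es n) (β := βs n)
        (U := U n) (U₁ := U (n + 1)) (χ₃ := χ n) (bf := g)
        (hΔn n) (hes0 n) (hUo n) (hUo (n + 1)) (hχd n) (hχc n) (hχU n) (hχ1 n) (hχle n)
        (hβs0 n) (hKβs n) hg hgb
    rw [← hlo_succ n, ← hhi_succ n] at hol₁ hol₂ holt hbt hfac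
    exact ⟨b₁, b₂, bt, ⟨holt, fun z h1 h2 h3 h4 h5 ↦ (hbt z h1 h2 h3 h4 h5).trans (hβs_step n)⟩,
      hol₁, hol₂, hbd₁, hbd₂, hfac⟩
  /- level `0` -/
  have h0 : Hyp 0 (fun z ↦ af z - 1) := by
    have hlo0 : lo 0 = c := cartanLevelLo_zero c ε
    have hhi0 : hi 0 = d := cartanLevelHi_zero d ε
    refine ⟨?_, fun z h1 h2 h3 h4 h5 ↦ ?_⟩
    · rw [hlo0, hhi0]; exact haf.sub_const 1
    · rw [hlo0] at h3; rw [hhi0] at h4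
      simpa [hβs] using hafβ z h1 h2 h3 h4 h5
  /- the recursion -/
  let S := {s : ℕ × (ℂ × P → 𝔄) // Hyp s.1 s.2}
  have hstepS : ∀ s : S, ∃ r : (ℂ × P → 𝔄) × (ℂ × P → 𝔄) × S,
      r.2.2.1.1 = s.1.1 + 1 ∧ Q s.1.1 s.1.2 r.1 r.2.1 r.2.2.1.2 := fun s ↦ by
    obtain ⟨b₁, b₂, g', hg', hQ⟩ := hstep s.1.1 s.1.2 s.2
    exact ⟨(b₁, b₂, ⟨(s.1.1 + 1, g'), hg'⟩), rfl, hQ⟩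
  choose F hF using hstepS
  let s₀ : S := ⟨(0, fun z ↦ af z - 1), h0⟩
  let seq : ℕ → S := fun n ↦ (fun s ↦ (F s).2.2)^[n] s₀
  have hseq_succ : ∀ n, seq (n + 1) = (F (seq n)).2.2 := fun n ↦
    Function.iterate_succ_apply' (fun s : S ↦ (F s).2.2) n s₀
  have hidx : ∀ n, (seq n).1.1 = n := by
    intro n
    induction n with
    | zero => rfl
    | succ n ih => rw [hseq_succ, (hF (seq n)).1, ih]
  let g : ℕ → (ℂ × P → 𝔄) := fun n ↦ (seq n).1.2
  let B₁ : ℕ → (ℂ × P → 𝔄) := fun n ↦ (F (seq n)).1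
  let B₂ : ℕ → (ℂ × P → 𝔄) := fun n ↦ (F (seq n)).2.1
  have hg0 : g 0 = fun z ↦ af z - 1 := rfl
  have hHyp : ∀ n, Hyp n (g n) := fun n ↦ by
    have h := (seq n).2
    rwa [hidx n] at h
  have hQn : ∀ n, Q n (g n) (B₁ n) (B₂ n) (g (n + 1)) := fun n ↦ by
    have h := (hF (seq n)).2
    rw [hidx n] at h
    show Q n (seq n).1.2 (F (seq n)).1 (F (seq n)).2.1 (seq (n + 1)).1.2
    rw [hseq_succ]
    exact h
  /- the terminal boxes -/
  set B'inf : Set (ℂ × P) := {z : ℂ × P | a < z.1.re ∧ z.1.re < b' ∧ c + 2 * ε < z.1.im ∧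
    z.1.im < d - 2 * ε ∧ z.2 ∈ Uinf} with hB'inf
  set B''inf : Set (ℂ × P) := {z : ℂ × P | a' < z.1.re ∧ z.1.re < b ∧ c + 2 * ε < z.1.im ∧
    z.1.im < d - 2 * ε ∧ z.2 ∈ Uinf} with hB''inf
  have hB'o : IsOpen B'inf := isOpen_box' a b' _ _ hUinfo
  have hB''o : IsOpen B''inf := isOpen_box' a' b _ _ hUinfo
  -- bounds and holomorphy of the factors on the terminal boxes
  have hB₁bd : ∀ n, ∀ z ∈ B'inf, ‖B₁ n z‖ ≤ K * βs n := fun n z ⟨h1, h2, h3, h4, _⟩ ↦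
    (hQn n).2.2.1 z h1 h2 (by linarith [hlo_lt n]) (by linarith [hhi_gt n])
  have hB₂bd : ∀ n, ∀ z ∈ B''inf, ‖B₂ n z‖ ≤ K * βs n := fun n z ⟨h1, h2, h3, h4, _⟩ ↦
    (hQn n).2.2.2.1 z h1 h2 (by linarith [hlo_lt n]) (by linarith [hhi_gt n])
  have hB₁hol : ∀ n, DifferentiableOn ℂ (B₁ n) B'inf := fun n ↦
    (hQn n).1.mono fun z ⟨_, h2, h3, h4, h5⟩ ↦
      ⟨h2, by linarith [hlo_lt (n + 1)], by linarith [hhi_gt (n + 1)], hUinf' n h5⟩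
  have hB₂hol : ∀ n, DifferentiableOn ℂ (B₂ n) B''inf := fun n ↦
    (hQn n).2.1.mono fun z ⟨h1, _, h3, h4, h5⟩ ↦
      ⟨h1, by linarith [hlo_lt (n + 1)], by linarith [hhi_gt (n + 1)], hUinf' n h5⟩
  -- the geometric sums
  have hgeom : ∀ n, ∑ ν ∈ Finset.range (n + 1), K * βs ν ≤ 2 * (K * β₀) := fun n ↦ by
    have hsum : Summable fun ν : ℕ ↦ t ^ ν := summable_geometric_of_lt_one ht0 ht1'
    have h1 : ∑ ν ∈ Finset.range (n + 1), t ^ ν ≤ ∑' ν, t ^ ν :=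
      hsum.sum_le_tsum _ fun ν _ ↦ pow_nonneg ht0 ν
    rw [tsum_geometric_of_lt_one ht0 ht1'] at h1
    have h2 : (1 - t)⁻¹ ≤ 2 := by
      rw [show (2 : ℝ) = (1 - 1 / 2)⁻¹ by norm_num]
      exact inv_anti₀ (by norm_num) (by linarith)
    calc ∑ ν ∈ Finset.range (n + 1), K * βs ν = K * β₀ * ∑ ν ∈ Finset.range (n + 1), t ^ ν := by
          rw [Finset.mul_sum]; refine Finset.sum_congr rfl fun ν _ ↦ ?_; simp only [hβs]; ring
      _ ≤ K * β₀ * 2 := mul_le_mul_of_nonneg_left (h1.trans h2) (by positivity)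
      _ = 2 * (K * β₀) := by ring
  /- the ordered products `uₙ = (1 + b'₀)⋯(1 + b'ₙ)` -/
  let u : ℕ → (ℂ × P → 𝔄) := fun n z ↦ prodOneAdd (fun ν ↦ B₁ ν z) n
  have hu_sum : ∀ n, ∀ z ∈ B'inf, 2 * ∑ ν ∈ Finset.range (n + 1), ‖B₁ ν z‖ ≤ 1 := fun n z hz ↦ by
    have : ∑ ν ∈ Finset.range (n + 1), ‖B₁ ν z‖ ≤ 2 * (K * β₀) :=
      (Finset.sum_le_sum fun ν _ ↦ hB₁bd ν z hz).trans (hgeom n)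
    linarith
  have hu1 : ∀ n, ∀ z ∈ B'inf, ‖u n z - 1‖ ≤ 4 * K * β₀ := fun n z hz ↦ by
    have h := norm_prodOneAdd_sub_one_le (fun ν ↦ B₁ ν z) n (hu_sum n z hz)
    have : ∑ ν ∈ Finset.range (n + 1), ‖B₁ ν z‖ ≤ 2 * (K * β₀) :=
      (Finset.sum_le_sum fun ν _ ↦ hB₁bd ν z hz).trans (hgeom n)
    exact h.trans (by linarith)
  have hu2 : ∀ n, ∀ z ∈ B'inf, ‖u n z‖ ≤ 2 := fun n z hz ↦ by
    calc ‖u n z‖ = ‖(u n z - 1) + 1‖ := by rw [sub_add_cancel]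
      _ ≤ ‖u n z - 1‖ + ‖(1 : 𝔄)‖ := norm_add_le _ _
      _ ≤ 4 * K * β₀ + 1 := by rw [norm_one]; exact add_le_add (hu1 n z hz) le_rfl
      _ ≤ 2 := by linarith
  have hudiff : ∀ n, ∀ z ∈ B'inf, ‖u (n + 1) z - u n z‖ ≤ 2 * K * β₀ * t * t ^ n := by
    intro n z hz
    have e : u (n + 1) z - u n z = u n z * B₁ (n + 1) z := by
      show prodOneAdd (fun ν ↦ B₁ ν z) (n + 1) - prodOneAdd (fun ν ↦ B₁ ν z) n = _
      rw [prodOneAdd_succ, mul_add, mul_one, add_sub_cancel_left]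
    rw [e]
    calc ‖u n z * B₁ (n + 1) z‖ ≤ ‖u n z‖ * ‖B₁ (n + 1) z‖ := norm_mul_le _ _
      _ ≤ 2 * (K * βs (n + 1)) := by
          gcongr
          · exact hu2 n z hz
          · exact hB₁bd (n + 1) z hz
      _ = 2 * K * β₀ * t * t ^ n := by simp only [hβs, pow_succ]; ring
  have hsumw : Summable fun n : ℕ ↦ 2 * K * β₀ * t * t ^ n :=
    (summable_geometric_of_lt_one ht0 ht1').mul_left _
  have hunif₁' := tendstoUniformlyOn_tsum_nat hsumw (f := fun n z ↦ u (n + 1) z - u n z)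
    (s := B'inf) fun n z hz ↦ hudiff n z hz
  set c₁ : ℂ × P → 𝔄 := u 0 + fun z ↦ ∑' n, (u (n + 1) z - u n z) with hc₁
  have hunif₁ : TendstoUniformlyOn u c₁ atTop B'inf := by
    have hconst : TendstoUniformlyOn (fun _ : ℕ ↦ u 0) (u 0) atTop B'inf :=
      tendstoUniformlyOn_of_forall_eq fun _ _ ↦ rfl
    refine (hconst.add hunif₁').congr (Eventually.of_forall fun N z _ ↦ ?_)
    show u 0 z + ∑ n ∈ Finset.range N, (u (n + 1) z - u n z) = u N z
    rw [Finset.sum_range_sub (fun n ↦ u n z) N, add_sub_cancel]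
  have hu_hol : ∀ N, DifferentiableOn ℂ (u N) B'inf := by
    intro N
    induction N with
    | zero =>
      exact ((hB₁hol 0).const_add 1).congr fun z _ ↦ prodOneAdd_zero (fun ν ↦ B₁ ν z)
    | succ N ih =>
      exact (ih.mul ((hB₁hol (N + 1)).const_add 1)).congr fun z _ ↦
        prodOneAdd_succ (fun ν ↦ B₁ ν z) N
  have hc₁hol : DifferentiableOn ℂ c₁ B'inf :=
    SCV.differentiableOn_of_tendstoLocallyUniformlyOn hB'o hu_hol hunif₁.tendstoLocallyUniformlyOn
  have hc₁lim : ∀ z ∈ B'inf, Tendsto (fun N ↦ u N z) atTop (𝓝 (c₁ z)) := fun z hz ↦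
    hunif₁.tendsto_at hz
  have hc₁bd : ∀ z ∈ B'inf, ‖c₁ z - 1‖ ≤ 4 * K * β₀ := fun z hz ↦
    le_of_tendsto ((hc₁lim z hz).sub_const 1).norm (Eventually.of_forall fun N ↦ hu1 N z hz)
  have h4K : 4 * K * β₀ < 1 := by linarith
  /- the ordered products `vₙ = (1 + b''ₙ)⋯(1 + b''₀)` -/
  let v : ℕ → (ℂ × P → 𝔄) := fun n z ↦ prodOneAddRev (fun ν ↦ B₂ ν z) n
  have hv_sum : ∀ n, ∀ z ∈ B''inf, 2 * ∑ ν ∈ Finset.range (n + 1), ‖B₂ ν z‖ ≤ 1 := fun n z hz ↦ by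
    have : ∑ ν ∈ Finset.range (n + 1), ‖B₂ ν z‖ ≤ 2 * (K * β₀) :=
      (Finset.sum_le_sum fun ν _ ↦ hB₂bd ν z hz).trans (hgeom n)
    linarith
  have hv1 : ∀ n, ∀ z ∈ B''inf, ‖v n z - 1‖ ≤ 4 * K * β₀ := fun n z hz ↦ by
    have h := norm_prodOneAddRev_sub_one_le (fun ν ↦ B₂ ν z) n (hv_sum n z hz)
    have : ∑ ν ∈ Finset.range (n + 1), ‖B₂ ν z‖ ≤ 2 * (K * β₀) :=
      (Finset.sum_le_sum fun ν _ ↦ hB₂bd ν z hz).trans (hgeom n)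
    exact h.trans (by linarith)
  have hv2 : ∀ n, ∀ z ∈ B''inf, ‖v n z‖ ≤ 2 := fun n z hz ↦ by
    calc ‖v n z‖ = ‖(v n z - 1) + 1‖ := by rw [sub_add_cancel]
      _ ≤ ‖v n z - 1‖ + ‖(1 : 𝔄)‖ := norm_add_le _ _
      _ ≤ 4 * K * β₀ + 1 := by rw [norm_one]; exact add_le_add (hv1 n z hz) le_rfl
      _ ≤ 2 := by linarith
  have hvdiff : ∀ n, ∀ z ∈ B''inf, ‖v (n + 1) z - v n z‖ ≤ 2 * K * β₀ * t * t ^ n := by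
    intro n z hz
    have e : v (n + 1) z - v n z = B₂ (n + 1) z * v n z := by
      show prodOneAddRev (fun ν ↦ B₂ ν z) (n + 1) - prodOneAddRev (fun ν ↦ B₂ ν z) n = _
      rw [prodOneAddRev_succ, add_mul, one_mul, add_sub_cancel_left]
    rw [e]
    calc ‖B₂ (n + 1) z * v n z‖ ≤ ‖B₂ (n + 1) z‖ * ‖v n z‖ := norm_mul_le _ _
      _ ≤ (K * βs (n + 1)) * 2 := by
          gcongr
          · exact hB₂bd (n + 1) z hz
          · exact hv2 n z hz
      _ = 2 * K * β₀ * t * t ^ n := by simp only [hβs, pow_succ]; ring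
  have hunif₂' := tendstoUniformlyOn_tsum_nat hsumw (f := fun n z ↦ v (n + 1) z - v n z)
    (s := B''inf) fun n z hz ↦ hvdiff n z hz
  set c₂ : ℂ × P → 𝔄 := v 0 + fun z ↦ ∑' n, (v (n + 1) z - v n z) with hc₂
  have hunif₂ : TendstoUniformlyOn v c₂ atTop B''inf := by
    have hconst : TendstoUniformlyOn (fun _ : ℕ ↦ v 0) (v 0) atTop B''inf :=
      tendstoUniformlyOn_of_forall_eq fun _ _ ↦ rfl
    refine (hconst.add hunif₂').congr (Eventually.of_forall fun N z _ ↦ ?_)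
    show v 0 z + ∑ n ∈ Finset.range N, (v (n + 1) z - v n z) = v N z
    rw [Finset.sum_range_sub (fun n ↦ v n z) N, add_sub_cancel]
  have hv_hol : ∀ N, DifferentiableOn ℂ (v N) B''inf := by
    intro N
    induction N with
    | zero =>
      exact ((hB₂hol 0).const_add 1).congr fun z _ ↦ prodOneAddRev_zero (fun ν ↦ B₂ ν z)
    | succ N ih =>
      exact ((((hB₂hol (N + 1)).const_add 1)).mul ih).congr fun z _ ↦
        prodOneAddRev_succ (fun ν ↦ B₂ ν z) N
  have hc₂hol : DifferentiableOn ℂ c₂ B''inf :=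
    SCV.differentiableOn_of_tendstoLocallyUniformlyOn hB''o hv_hol hunif₂.tendstoLocallyUniformlyOn
  have hc₂lim : ∀ z ∈ B''inf, Tendsto (fun N ↦ v N z) atTop (𝓝 (c₂ z)) := fun z hz ↦
    hunif₂.tendsto_at hz
  have hc₂bd : ∀ z ∈ B''inf, ‖c₂ z - 1‖ ≤ 4 * K * β₀ := fun z hz ↦
    le_of_tendsto ((hc₂lim z hz).sub_const 1).norm (Eventually.of_forall fun N ↦ hv1 N z hz)
  /- the factorisations `a = uₙ (1 + b_{n+1}) vₙ` on the level-`(n+1)` middle box -/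
  have hfac : ∀ n (z : ℂ × P), a' < z.1.re → z.1.re < b' → lo (n + 1) < z.1.im →
      z.1.im < hi (n + 1) → z.2 ∈ U (n + 1) → af z = u n z * (1 + g (n + 1) z) * v n z := by
    intro n
    induction n with
    | zero =>
      intro z h1 h2 h3 h4 h5
      have h := (hQn 0).2.2.2.2 z h1 h2 h3 h4 h5
      have e0 : (1 : 𝔄) + g 0 z = af z := by rw [hg0]; exact add_sub_cancel 1 (af z)
      rw [e0] at h
      rw [h]
      show _ = prodOneAdd (fun ν ↦ B₁ ν z) 0 * (1 + g 1 z) * prodOneAddRev (fun ν ↦ B₂ ν z) 0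
      rw [prodOneAdd_zero, prodOneAddRev_zero]
    | succ n ih =>
      intro z h1 h2 h3 h4 h5
      have h3' : lo (n + 1) < z.1.im := (hlo_mono (n + 1)).trans_lt h3
      have h4' : z.1.im < hi (n + 1) := h4.trans_le (hhi_anti (n + 1))
      have h5' : z.2 ∈ U (n + 1) := hUanti (n + 1) h5
      rw [ih z h1 h2 h3' h4' h5', (hQn (n + 1)).2.2.2.2 z h1 h2 h3 h4 h5]
      show prodOneAdd (fun ν ↦ B₁ ν z) n * ((1 + B₁ (n + 1) z) * (1 + g (n + 1 + 1) z) *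
          (1 + B₂ (n + 1) z)) * prodOneAddRev (fun ν ↦ B₂ ν z) n =
        prodOneAdd (fun ν ↦ B₁ ν z) (n + 1) * (1 + g (n + 1 + 1) z) *
          prodOneAddRev (fun ν ↦ B₂ ν z) (n + 1)
      rw [prodOneAdd_succ, prodOneAddRev_succ]
      simp only [mul_assoc]
  /- conclusion -/
  refine ⟨c₁, c₂, hc₁hol, hc₂hol, fun z h1 h2 h3 h4 h5 ↦ ?_, fun z h1 h2 h3 h4 h5 ↦ ?_,
    fun z h1 h2 h3 h4 h5 ↦ ?_⟩
  · have hz : z ∈ B'inf := ⟨h1, h2, h3, h4, h5⟩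
    exact ⟨isUnit_of_norm_sub_one_lt ((hc₁bd z hz).trans_lt h4K), hc₁bd z hz⟩
  · have hz : z ∈ B''inf := ⟨h1, h2, h3, h4, h5⟩
    exact ⟨isUnit_of_norm_sub_one_lt ((hc₂bd z hz).trans_lt h4K), hc₂bd z hz⟩
  · have hz₁ : z ∈ B'inf := ⟨by linarith, h2, h3, h4, h5⟩
    have hz₂ : z ∈ B''inf := ⟨h1, by linarith, h3, h4, h5⟩
    -- `a z = uₙ z (1 + b_{n+1} z) vₙ z` for all `n`, and the right side tends to `c₁ z · 1 · c₂ z`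
    have hconst : ∀ n, af z = u n z * (1 + g (n + 1) z) * v n z := fun n ↦
      hfac n z h1 h2 (by linarith [hlo_lt (n + 1)]) (by linarith [hhi_gt (n + 1)]) (hUinf' n h5)
    have hg_to : Tendsto (fun n ↦ g (n + 1) z) atTop (𝓝 0) := by
      refine squeeze_zero_norm (fun n ↦ (hHyp (n + 1)).2 z h1 h2 (by linarith [hlo_lt (n + 1)])
        (by linarith [hhi_gt (n + 1)]) (hUinf' n h5)) ?_
      have : Tendsto (fun n ↦ β₀ * t ^ (n + 1)) atTop (𝓝 (β₀ * 0)) :=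
        ((tendsto_pow_atTop_nhds_zero_of_lt_one ht0 ht1').comp (tendsto_add_atTop_nat 1)).const_mul β₀
      simpa [hβs] using this
    have hlim : Tendsto (fun n ↦ u n z * (1 + g (n + 1) z) * v n z) atTop
        (𝓝 (c₁ z * (1 + 0) * c₂ z)) :=
      ((hc₁lim z hz₁).mul (hg_to.const_add 1)).mul (hc₂lim z hz₂)
    rw [add_zero, mul_one] at hlim
    have hlim' : Tendsto (fun _ : ℕ ↦ af z) atTop (𝓝 (c₁ z * c₂ z)) :=
      hlim.congr fun n ↦ (hconst n).symm
    exact tendsto_nhds_unique tendsto_const_nhds hlim'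

end CartanIteration

/-! ### Polydisc parameters: the user-facing form -/

section Polydisc
variable {ι : Type*} [Fintype ι]
  {𝔄 : Type*} [NormedRing 𝔄] [NormedAlgebra ℂ 𝔄] [CompleteSpace 𝔄] [NormOneClass 𝔄]

omit [Fintype ι] in
/-- Radii of the decreasing parameter polydiscs: `ρₙ = r∞ + (r − r∞)/2ⁿ`. [folklore] -/
private theorem radius_facts {r rinf : ι → ℝ} (hrinf : ∀ i, 0 < rinf i) (hr : ∀ i, rinf i < r i)
    (n : ℕ) (i : ι) :
    rinf i < rinf i + (r i - rinf i) / 2 ^ n ∧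
      rinf i + (r i - rinf i) / 2 ^ (n + 1) < rinf i + (r i - rinf i) / 2 ^ n ∧
      0 < rinf i + (r i - rinf i) / 2 ^ (n + 1) := by
  have h1 : 0 < r i - rinf i := sub_pos.2 (hr i)
  have h2 : (0 : ℝ) < 2 ^ n := by positivity
  refine ⟨by have := div_pos h1 h2; linarith, ?_, by have := hrinf i; positivity⟩
  have : (r i - rinf i) / 2 ^ (n + 1) < (r i - rinf i) / 2 ^ n := by
    rw [pow_succ]
    exact div_lt_div_of_pos_left h1 h2 (by linarith)
  linarith

/-- **Product cut-offs with values of norm `≤ 1`** (Mathlib's `ContDiffBump` in each coordinate,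
as in `Literature.Analysis.Complex.exists_polydisc_cutoff`, recording moreover `0 ≤ χ ≤ 1`): for radii
`0 < aᵢ < bᵢ` a `C¹` compactly supported `χ` on `ℂ^ι`, `= 1` on the closed polydisc of radii `a`,
supported in the closed polydisc of radii `b`, `‖χ‖ ≤ 1`. [folklore] -/
theorem exists_polydisc_cutoff_norm_le_one (p₀ : ι → ℂ) {α β : ι → ℝ} (hα : ∀ i, 0 < α i)
    (hαβ : ∀ i, α i < β i) :
    ∃ χ : (ι → ℂ) → ℂ, ContDiff ℝ 1 χ ∧ HasCompactSupport χ ∧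
      tsupport χ ⊆ Set.pi univ (fun i ↦ closedBall (p₀ i) (β i)) ∧
      (∀ z ∈ Set.pi univ (fun i ↦ closedBall (p₀ i) (α i)), χ z = 1) ∧ ∀ z, ‖χ z‖ ≤ 1 := by
  let ψ : ∀ i : ι, ContDiffBump (p₀ i) := fun i ↦ ⟨α i, β i, hα i, hαβ i⟩
  have hsupp : ∀ z : ι → ℂ, (∏ i, ((ψ i) (z i) : ℂ)) ≠ 0 →
      z ∈ Set.pi univ fun i ↦ closedBall (p₀ i) (β i) := fun z hz i _ ↦ by
    have h : (ψ i) (z i) ≠ 0 := fun h0 ↦ hz (Finset.prod_eq_zero (Finset.mem_univ i) (by simp [h0]))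
    have : z i ∈ Function.support (ψ i) := h
    rw [(ψ i).support_eq] at this
    exact ball_subset_closedBall this
  refine ⟨fun z ↦ ∏ i, ((ψ i) (z i) : ℂ), ?_, ?_, ?_, ?_, ?_⟩
  · exact contDiff_prod fun i _ ↦ ofRealCLM.contDiff.comp
      ((ψ i).contDiff.comp (contDiff_apply ℝ ℂ i))
  · exact HasCompactSupport.of_support_subset_isCompact
      (isCompact_univ_pi fun i ↦ isCompact_closedBall (p₀ i) (β i)) fun z hz ↦ hsupp z hz
  · exact closure_minimal (fun z hz ↦ hsupp z hz) (isClosed_set_pi fun i _ ↦ isClosed_closedBall)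
  · intro z hz
    exact Finset.prod_eq_one fun i _ ↦ by
      rw [(ψ i).one_of_mem_closedBall (hz i (mem_univ i)), ofReal_one]
  · intro z
    rw [norm_prod]
    exact Finset.prod_le_one (fun i _ ↦ norm_nonneg _) fun i _ ↦ by
      rw [norm_real, Real.norm_of_nonneg (ψ i).nonneg]; exact (ψ i).le_one

/-- **Cartan's Heftungslemma with polydisc parameters (GR Kap. III §1.3, Satz 4, shrunken
form).** See the module docstring. [cite: GrauertRemmert1977, Kap. III §1.3 Satz 4] -/
theorem cartan_heftung_polydisc {a a' b' b δ : ℝ} (haa' : a ≤ a') (hb'b : b' ≤ b) (hδ : 0 < δ)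
    (hab : a' + δ < b' - δ) {c d ε : ℝ} (hε : 0 < ε) (hcd : c + 2 * ε ≤ d - 2 * ε)
    (p₀ : ι → ℂ) {r rinf : ι → ℝ} (hrinf : ∀ i, 0 < rinf i) (hr : ∀ i, rinf i < r i) :
    ∃ K β₀ : ℝ, 1 ≤ K ∧ 0 < β₀ ∧ ∀ (af : ℂ × (ι → ℂ) → 𝔄) (N : ℝ), 0 ≤ N → N ≤ β₀ →
      DifferentiableOn ℂ af {z : ℂ × (ι → ℂ) | a' < z.1.re ∧ z.1.re < b' ∧ c < z.1.im ∧
        z.1.im < d ∧ z.2 ∈ polydisc p₀ r} →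
      (∀ z : ℂ × (ι → ℂ), a' < z.1.re → z.1.re < b' → c < z.1.im → z.1.im < d →
        z.2 ∈ polydisc p₀ r → ‖af z - 1‖ ≤ N) →
      ∃ c₁ c₂ : ℂ × (ι → ℂ) → 𝔄,
        DifferentiableOn ℂ c₁ {z : ℂ × (ι → ℂ) | a < z.1.re ∧ z.1.re < b' ∧ c + 2 * ε < z.1.im ∧
          z.1.im < d - 2 * ε ∧ z.2 ∈ polydisc p₀ rinf} ∧
        DifferentiableOn ℂ c₂ {z : ℂ × (ι → ℂ) | a' < z.1.re ∧ z.1.re < b ∧ c + 2 * ε < z.1.im ∧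
          z.1.im < d - 2 * ε ∧ z.2 ∈ polydisc p₀ rinf} ∧
        (∀ z : ℂ × (ι → ℂ), a < z.1.re → z.1.re < b' → c + 2 * ε < z.1.im → z.1.im < d - 2 * ε →
          z.2 ∈ polydisc p₀ rinf → IsUnit (c₁ z) ∧ ‖c₁ z - 1‖ ≤ 4 * K * N) ∧
        (∀ z : ℂ × (ι → ℂ), a' < z.1.re → z.1.re < b → c + 2 * ε < z.1.im → z.1.im < d - 2 * ε →
          z.2 ∈ polydisc p₀ rinf → IsUnit (c₂ z) ∧ ‖c₂ z - 1‖ ≤ 4 * K * N) ∧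
        (∀ z : ℂ × (ι → ℂ), a' < z.1.re → z.1.re < b' → c + 2 * ε < z.1.im → z.1.im < d - 2 * ε →
          z.2 ∈ polydisc p₀ rinf → af z = c₁ z * c₂ z) := by
  classical
  -- the Cousin constant, enlarged to `K ≥ 1`
  obtain ⟨K₀, hK₀0, hK₀⟩ := cousin_heftung (P := ι → ℂ) (F := 𝔄) haa' hb'b hδ hab
    (abs_nonneg (d - c))
  set K : ℝ := max K₀ 1 with hKdef
  have hK1 : 1 ≤ K := le_max_right _ _
  have hK0K : K₀ ≤ K := le_max_left _ _
  have hK : ∀ (c' d' ε' : ℝ) (f : ℂ × (ι → ℂ) → 𝔄) (U U₁ : Set (ι → ℂ)) (χ₃ : (ι → ℂ) → ℂ)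
      (N : ℝ), |d' - c'| ≤ |d - c| → 0 < ε' →
      IsOpen U → IsOpen U₁ → ContDiff ℝ 1 χ₃ → HasCompactSupport χ₃ → tsupport χ₃ ⊆ U →
      (∀ p ∈ U₁, χ₃ p = 1) → (∀ p, ‖χ₃ p‖ ≤ 1) → 0 ≤ N →
      DifferentiableOn ℂ f
        {z : ℂ × (ι → ℂ) | a' < z.1.re ∧ z.1.re < b' ∧ c' < z.1.im ∧ z.1.im < d' ∧ z.2 ∈ U} →
      (∀ z : ℂ × (ι → ℂ), a' < z.1.re → z.1.re < b' → c' < z.1.im → z.1.im < d' → z.2 ∈ U →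
        ‖f z‖ ≤ N) →
      ∃ f' f'' : ℂ × (ι → ℂ) → 𝔄,
        DifferentiableOn ℂ f'
          {z : ℂ × (ι → ℂ) | z.1.re < b' ∧ c' + 2 * ε' < z.1.im ∧ z.1.im < d' - 2 * ε' ∧
            z.2 ∈ U₁} ∧
        DifferentiableOn ℂ f''
          {z : ℂ × (ι → ℂ) | a' < z.1.re ∧ c' + 2 * ε' < z.1.im ∧ z.1.im < d' - 2 * ε' ∧
            z.2 ∈ U₁} ∧
        (∀ z : ℂ × (ι → ℂ), a' < z.1.re → z.1.re < b' → c' + 2 * ε' < z.1.im →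
          z.1.im < d' - 2 * ε' → z.2 ∈ U₁ → f z = f' z + f'' z) ∧
        (∀ z : ℂ × (ι → ℂ), a < z.1.re → z.1.re < b' → c' < z.1.im → z.1.im < d' →
          ‖f' z‖ ≤ K * N) ∧
        (∀ z : ℂ × (ι → ℂ), a' < z.1.re → z.1.re < b → c' < z.1.im → z.1.im < d' →
          ‖f'' z‖ ≤ K * N) := by
    intro c' d' ε' f U U₁ χ₃ N h1 h2 h3 h4 h5 h6 h7 h8 h9 h10 h11 h12
    obtain ⟨f', f'', q1, q2, q3, q4, q5⟩ := hK₀ c' d' ε' f U U₁ χ₃ N h1 h2 h3 h4 h5 h6 h7 h8 h9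
      h10 h11 h12
    exact ⟨f', f'', q1, q2, q3,
      fun z w1 w2 w3 w4 ↦ (q4 z w1 w2 w3 w4).trans (mul_le_mul_of_nonneg_right hK0K h10),
      fun z w1 w2 w3 w4 ↦ (q5 z w1 w2 w3 w4).trans (mul_le_mul_of_nonneg_right hK0K h10)⟩
  -- the radii, polydiscs and cut-offs
  set ρ : ℕ → ι → ℝ := fun n i ↦ rinf i + (r i - rinf i) / 2 ^ n with hρ
  have hρ0 : ρ 0 = r := by funext i; simp [hρ]
  obtain hρfacts := fun n i ↦ radius_facts hrinf hr n i
  have hχex : ∀ n : ℕ, ∃ χ : (ι → ℂ) → ℂ, ContDiff ℝ 1 χ ∧ HasCompactSupport χ ∧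
      tsupport χ ⊆ Set.pi univ (fun i ↦ closedBall (p₀ i) ((ρ n i + ρ (n + 1) i) / 2)) ∧
      (∀ z ∈ Set.pi univ (fun i ↦ closedBall (p₀ i) (ρ (n + 1) i)), χ z = 1) ∧
      ∀ z, ‖χ z‖ ≤ 1 := fun n ↦
    exists_polydisc_cutoff_norm_le_one p₀ (fun i ↦ (hρfacts n i).2.2) fun i ↦ by
      have := (hρfacts n i).2.1
      change ρ (n + 1) i < (ρ n i + ρ (n + 1) i) / 2
      linarith
  choose χ hχd hχc hχsupp hχ1 hχle using hχex
  set U : ℕ → Set (ι → ℂ) := fun n ↦ polydisc p₀ (ρ n) with hU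
  have hUo : ∀ n, IsOpen (U n) := fun n ↦ isOpen_polydisc p₀ (ρ n)
  have hχU : ∀ n, tsupport (χ n) ⊆ U n := fun n ↦
    (hχsupp n).trans (pi_closedBall_subset_polydisc p₀ fun i ↦ by
      have := (hρfacts n i).2.1
      change (ρ n i + ρ (n + 1) i) / 2 < ρ n i
      linarith)
  have hχ1' : ∀ n, ∀ p ∈ U (n + 1), χ n p = 1 := fun n p hp ↦
    hχ1 n p (polydisc_subset_pi_closedBall p₀ (ρ (n + 1)) hp)
  have hUinf : ∀ n, polydisc p₀ rinf ⊆ U n := fun n ↦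
    polydisc_mono p₀ fun i ↦ (hρfacts n i).1.le
  -- the constants
  have hK0 : 0 < K := by linarith
  refine ⟨K, 1 / (8 * K ^ 2), hK1, by positivity, ?_⟩
  intro af N hN hNβ haf hafN
  have hsmall : 8 * K ^ 2 * N ≤ 1 := by
    have h := mul_le_mul_of_nonneg_left hNβ (by positivity : (0 : ℝ) ≤ 8 * K ^ 2)
    rwa [mul_one_div_cancel (by positivity)] at h
  have haf' : DifferentiableOn ℂ af {z : ℂ × (ι → ℂ) | a' < z.1.re ∧ z.1.re < b' ∧ c < z.1.im ∧
      z.1.im < d ∧ z.2 ∈ U 0} := by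
    simp only [hU, hρ0]; exact haf
  have hafN' : ∀ z : ℂ × (ι → ℂ), a' < z.1.re → z.1.re < b' → c < z.1.im → z.1.im < d →
      z.2 ∈ U 0 → ‖af z - 1‖ ≤ N := by
    simp only [hU, hρ0]; exact hafN
  exact cartan_heftung (P := ι → ℂ) haa' hb'b hK1 hK hε hcd le_rfl hN hsmall hUo hχd hχc hχU
    hχ1' hχle (isOpen_polydisc p₀ rinf) hUinf haf' hafN'

end Polydisc

end Literature.Analysis.Complex

end
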